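import Summits.ABC.IUTFork.Repair.ModelColumnVarying2
import Summits.ABC.IUTFork.Repair.CandJoshi30
import HarnessLib

/-!
# REPAIR branch — E1, part IV: rp-j3's line-varying JOSHI premise RP-J30a/b (`CandJoshi30`: «distinct arithmetic holomorphic structures
# across the link» / «… related by ONE indeterminacy move») on the column-varying bed CV — a SAT♮ cell

Proof-only file (no definition, no candidate, no `Prop` fact) of the abc-iut cell's IUT REPAIR branch (rung LADDER-ABC:A2.RP ⊆ A2.B), seat
abc-iut-w5-d049; sequel of `Repair/ModelColumnVarying` (p431817) / `ModelColumnVarying2` (p432127). TAKES NO SIDE between Mochizuki,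
Scholze–Stix, Joshi or anyone; nothing here asserts abc or [IUTchIII] Cor. 3.12 proved or refuted; models are TEST OBJECTS; typed ≠ proved;
instantiated ≠ endorsed. rp-j3's `CandJoshi30` (p431570; `H` := `S.D (P.n − 1) ≠ S.D P.n`, `H'` := `H ∧ MRData.IndMoves (S.D P.n) (S.D (P.n − 1))`,
sources ATS III Thm. 6.3.1 / Rmk. 4.2.3.2 (1) / §8.11.1, Quest2023 §1.3 as quoted THERE) is consumed BY NAME, zero edits.
[claim: Joshi2024ATSIII, status: disputed] [claim: Mochizuki2012, status: disputed]

WHY. `CandJoshi30`'s cells of record live on abc-iut-w5-d247's line-varying beds over `varyingFull p`: at CMᵛ (`varyingPinnedSetting`) `H'`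
holds with `¬S ∧ ¬Statement`, at the identified corner P♭ᵛ (`varyingLinkIdSetting`) with `S ∧ Statement` — grade SAT0 (`H'_satisfiable`),
and at P♮ (constant lines) `H` fails vacuously. The column-varying bed CV is line-varying AND non-identified: its line `n − 1 = −1` is BY
CONSTRUCTION the `flipFamily`-transport of line `n = 0` — one (Ind2)-move onto a DIFFERENT record.

RESULTS (ns `Summit.ABC.IUTFork.Repair.ModelColumnVarying`): `J30_on_CV` — `H` and `H'` HOLD at `cvSetting` and at `cvSettingId` (the rows
read neither `ρ` nor `qK`, `CandJoshi30.H_blind`); `J30b_satCV` — **RP-J30b (hence RP-J30a) is SAT♮**: jointly satisfiable with the typed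
Thm. 3.11 (i)(ii)(iii), «columns `n−1 ≠ n`», BridgeHyps, `|log(q)| > 0`, PinnedRegions3, all four levels of record, the residual `S`, the
Statement with STRICT inequality and `¬IdentifiedReading` — the first bed on which Joshi's typed line-varying premise, the residual and a
non-identified contentful Statement hold TOGETHER; `J30_blind_on_CV` — and, on the SAME situation, `H'` also holds at the identified twin
(kummer clause true): consistent with rp-j3's BLINDNESS reading (the premise cannot tell the two settings apart, so it supplies nothing by
itself — `CandJoshi30.H'_not_supplier` stands). A model ≠ an endorsement; no side taken.
-/

noncomputable section

open Set

namespace Summit.ABC.IUTFork.Repair.ModelColumnVarying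

open Thm311 Cor312 Cor312.Checks Cor312.IdentifiedNonVacuity Cor312Vol Cor312Vol.NaiveWitness Cor312Vol.PinnedWitness
  Cor312Vol.NaturalWitness Literature.IUT.LogThetaLattice

/-! ## 19. RP-J30a/b on CV -/

/-- On CV the link's two lines carry DISTINCT records, the Θ-side one being ONE (Ind2)-move (`flipFamily`) of the q-side one — for any
setting at column `0`. [folklore] -/
theorem cv_lines_distinct_one_move :
    cvFull.D (0 - 1) ≠ cvFull.D 0 ∧ MRData.IndMoves (cvFull.D 0) (cvFull.D (0 - 1)) := by
  refine ⟨fun h => cv_line_regions_ne (Setting.labelSucc_ne_zero (⟨0, by decide⟩ : Fin toyIndex.lstar)) () (by rw [h]),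
    flipFamily, Or.inr flipFamily_mem_Ind2Family, ?_⟩
  show cvLineData (0 - 1) = natData.map flipFamily
  exact cvLineData_of_ne_zero (by decide)

/-- **RP-J30a `H` and RP-J30b `H'` HOLD at `cvSetting` AND at the identified twin `cvSettingId`** (both sit at column `0`; the rows read
neither the operator nor the datum). [claim: Joshi2024ATSIII, status: disputed] -/
theorem J30_on_CV :
    (CandJoshi30.H cvFull.toLatticeSituation cvSetting segRegion qDatumNat ∧
      CandJoshi30.H' cvFull.toLatticeSituation cvSetting segRegion qDatumNat) ∧
    (CandJoshi30.H cvFull.toLatticeSituation cvSettingId segRegion (fun v _ => PsiNat v) ∧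
      CandJoshi30.H' cvFull.toLatticeSituation cvSettingId segRegion (fun v _ => PsiNat v)) :=
  ⟨⟨cv_lines_distinct_one_move.1, cv_lines_distinct_one_move⟩, ⟨cv_lines_distinct_one_move.1, cv_lines_distinct_one_move⟩⟩

/-- **RP-J30b is SAT♮ on CV**: Joshi's typed line-varying premise (distinct adjacent records, one indeterminacy move apart) holds TOGETHER
WITH the typed Thm. 3.11, distinct columns, every bridge hypothesis, `|log(q)| > 0`, all three pins, all four levels of record, the residual
`S`, the Statement with STRICT inequality and `¬IdentifiedReading` — upgrade of the SAT0 cell of record (`CandJoshi30.H'_satisfiable` at the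
identified corner P♭ᵛ). [claim: Joshi2024ATSIII, status: disputed] -/
theorem J30b_satCV :
    ∃ (T : ThetaIndex) (F : FullSituation T) (P : Cor312.Setting F.toLatticeSituation.toSituation)
      (ρ : (∀ v : T.V, v ∈ T.Vbad → Set (F.L.StarPacket v)) → ∀ (j : T.Label) (vQ : T.VQ), Set (F.L.Packet j vQ))
      (qK : ∀ v : T.V, v ∈ T.Vbad → Set (F.L.StarPacket v)),
      F.Statement ∧ F.col (P.n - 1) ≠ F.col P.n ∧ BridgeHyps P ∧ P.AbsLogQPos ∧ PinnedRegions3 F.toLatticeSituation P ρ qK ∧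
        CandJoshi30.H' F.toLatticeSituation P ρ qK ∧
        PilotKummerCompat F.toLatticeSituation P qK ∧ PilotKummerCompatRegion F.toLatticeSituation P ρ qK ∧
        PilotKummerIndRelated F.toLatticeSituation P ρ qK ∧ PilotKummerCompatHull F.toLatticeSituation P ρ qK ∧
        P.Statement ∧ ((P.negLogQ : ℝ) : WithTop ℝ) < P.negLogTheta ∧ ¬ P.IdentifiedReading :=
  ⟨toyIndex, cvFull, cvSetting, segRegion, qDatumNat, cvFull_statement, cv_columns_ne, cvSetting_census.1, cvSetting_census.2.1,
    cvSetting_census.2.2.1, J30_on_CV.1.2, cvSetting_levels.1, cvSetting_levels.2.1, cvSetting_levels.2.2.1, cvSetting_levels.2.2.2,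
    cvSetting_census.2.2.2.2.1, cvSetting_census.2.2.2.2.2, cvSetting_census.2.2.2.1⟩

/-- **BLINDNESS on one situation** (rp-j3's reading, instantiated on CV): over the SAME full situation `cvFull`, `H'` holds BOTH at the honest
setting `cvSetting` (q-region `halfNeg ≠ halfPos`, `kummer` clause FALSE) AND at the identified twin `cvSettingId` (`kummer` clause TRUE) —
the premise does not read the regions, so it cannot decide between them. [folklore] -/
theorem J30_blind_on_CV :
    (CandJoshi30.H' cvFull.toLatticeSituation cvSetting segRegion qDatumNat ∧
      ¬ ∀ (m : ℤ) (j : toyIndex.Label) (vQ : toyIndex.VQ), cvSetting.thetaRegion m j vQ = cvSetting.qRegion j vQ) ∧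
    (CandJoshi30.H' cvFull.toLatticeSituation cvSettingId segRegion (fun v _ => PsiNat v) ∧
      ∀ (m : ℤ) (j : toyIndex.Label) (vQ : toyIndex.VQ), cvSettingId.thetaRegion m j vQ = cvSettingId.qRegion j vQ) :=
  ⟨⟨J30_on_CV.1.2, cvSetting_structural.1⟩, ⟨J30_on_CV.2.2, cvSettingId_S_kummer_not_identified.2.1⟩⟩

end Summit.ABC.IUTFork.Repair.ModelColumnVarying

end
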